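import Mathlib.Analysis.Analytic.Basic
import Mathlib.Analysis.SpecialFunctions.Complex.Arg
import Mathlib.Data.Set.Card
import Mathlib.Topology.Algebra.InfiniteSum.Real
import HarnessLib

/-!
# Fabry's theorem on the sign changes of the coefficients of a power series (Fabry–Pólya), segment form

**Fabry's theorem** [cite: Fabry1898] in Pólya's maximum-density formulation [cite: Polya1929]
(complete proof: [cite: Bieberbach1955]; modern statement: [cite: Eremenko2008, Theorem A and
Corollary 1]).  For a real sequence `(aₘ)` a SIGN CHANGE occurs at the place `m` if `aₘ aₖ < 0` for some
`k < m` while `aⱼ = 0` for `k < j < m` (Eremenko, §1).  The MAXIMUM DENSITY of a set `Λ ⊆ ℕ` is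
`D₂(Λ) = lim_{r→0+} limsup_{t→∞} (n((1+r)t, Λ) − n(t, Λ))/(r t)` (Pólya).  THEOREM A (Fabry), case
`βₖ = 0` of a real sequence, as weakened in Corollary 1: if `f(z) = Σ aₘ zᵐ` has radius of convergence
`1` and the set of sign changes of `(aₘ)` has maximum density `≤ Δ`, then `f` has a singularity on the
closed arc `I_Δ = {e^{iθ} : |θ| ≤ πΔ}`, i.e. there is no immediate analytic continuation of `f` from the
unit disc to the whole arc `I_Δ`.

We record the theorem as a NAMED FACT (`def … : Prop`, D-0014; not yet proved in the tree) in the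
SEGMENT FORM in which it is used to continue expansions along the positive real axis — exactly parallel
to the tree's PROVED `Δ = 0`/no-sign-change case, the Vivanti–Pringsheim theorem
`Literature.Analysis.Complex.summable_mul_pow_of_nonneg_of_analyticAt`
(`Literature/Analysis/Complex/PringsheimNonnegativeCoefficients.lean`): for a real sequence `a`, a
function `F : ℂ → ℂ`, `b > 0` and `Δ ≥ 0` — if for every `r ∈ (0,1)` and `ε > 0` the sign-change places
in each window `(t, (1+r)t]` number at most `(Δ + ε)·r·t` for `t` large (so the set of sign changes has
maximum density `≤ Δ`), `F` is analytic at every `z` with `‖z‖ < b` and `|arg z| ≤ πΔ`, and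
`Σ aₙ zⁿ = F(z)` on a neighbourhood of `0` — then `Σ aₙ tⁿ` converges for every `t ∈ [0, b)`.

Reduction of the segment form to Theorem A (on paper; refereed in cell pub/rh-split, rh-split-ref-2 g6
CENSUS #33, 2026-08-27, «faithful-or-weaker than Thm A / Cor 1»): let `R > 0` be the radius of convergence
of `Σ aₙ zⁿ` (positive by the germ hypothesis; if `R = ∞` there is nothing to prove) and suppose `R < b`.
Rescaling `z ↦ Rz` does not move the sign changes, so by Theorem A (with `βₖ = 0`, `mₖ` a sequence with
`|a_{mₖ} R^{mₖ}|^{1/mₖ} → 1`, and `D₂(⋃ₖ Λₖ) ≤ D₂(all sign changes) ≤ Δ`) the function `f = Σ aₙ zⁿ` has a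
singular point on the arc `{R e^{iθ} : |θ| ≤ πΔ}`.  But `F` is analytic at every point of the closed sector
`{‖z‖ < b, |arg z| ≤ πΔ} ∋ 0`, which is star-shaped about `0`, so `F = f` on the part of that sector inside
the disc of convergence (identity theorem) and every point of the arc is a regular point of `f` — a
contradiction.  Hence `R ≥ b` and `Σ aₙ tⁿ` converges (absolutely) for `0 ≤ t < b`.  For `Δ ≥ 1` the sector
is the whole disc and the statement is the elementary «analytic in `‖z‖ < b` ⟹ radius `≥ b`».

Design: the windowed count is written with `Set.ncard` over real window ends `t` (the set is finite, being
contained in `(t, 2t]`); `|Complex.arg z| ≤ Real.pi * Δ` is the closed sector (`arg ∈ (−π, π]`).  Deliberately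
NOT here: the general Theorem A with rotations `βₖ` and large-coefficient subsequences `mₖ`, the
Arakelyan–Martirosyan and Eremenko interior-density improvements (Theorems B, 1 of [Eremenko2008]), and
Fabry's GAP theorem (Corollary 2) — state them when a user needs them.
-- TODO(general form): Eremenko2008 Theorem A (rotated projections `Re(e^{-iβₖ} aₘ)`, densities measured
-- only near a subsequence of large coefficients) and Theorem 1 (Beurling–Malliavin-type interior density).

## References
* [Fabry1898] E. Fabry, *Sur les séries de Taylor qui ont une infinité de points singuliers*, Acta Math. 22 (1898) 65–87.
* [Polya1929] G. Pólya, *Untersuchungen über Lücken und Singularitäten von Potenzreihen*, Math. Z. 29 (1929) 549–640.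
* [Bieberbach1955] L. Bieberbach, *Analytische Fortsetzung*, Ergebnisse 3, Springer 1955 (complete proof of Theorem A).
* [Eremenko2008] A. Eremenko, *Densities in Fabry's theorem*, Illinois J. Math. 52 (2008) 1277–1290, arXiv:0709.2360, §1 Theorem A, Corollary 1.
* Used by: route `Summits/RiemannHypothesis/RiemannHypothesis/Theses/ScrewFabry.lean` (X-16 «Fabry exchange»), whose
  support item `FabryFact` is this statement verbatim.
-/

namespace Literature.Analysis.Complex

/-- **Fabry's sign-change theorem (Fabry 1898 / Pólya 1929 maximum density; Bieberbach 1955), segment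
form.**  For a real sequence `a`, `F : ℂ → ℂ`, `b > 0`, `Δ ≥ 0`: if the places `m` where a sign change of
`a` occurs (`aₖ · aₘ < 0` for the previous non-zero index `k`) number at most `(Δ + ε)·r·t` in every window
`(t, (1+r)t]`, `r ∈ (0,1)`, `ε > 0`, `t ≥ T(r, ε)` (maximum density of the sign changes `≤ Δ`), if `F` is
analytic at every `z` with `‖z‖ < b`, `|arg z| ≤ πΔ`, and if `Σ aₙ zⁿ = F z` for all `z` near `0`, then
`Σ aₙ tⁿ` converges for every `t ∈ [0, b)`.  (Consequence of Theorem A / Corollary 1 as printed, by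
rescaling to radius `1` and the identity theorem on the star-shaped closed sector; see the module
docstring.  Named fact, not yet proved in the tree; the case `Δ = 0` with `aₙ ≥ 0` is the proved
`summable_mul_pow_of_nonneg_of_analyticAt`.)
[cite: Eremenko2008, §1 Theorem A and Corollary 1 (Fabry 1898; Pólya 1929; Bieberbach 1955)] -/
def FabrySignChanges : Prop :=
  ∀ (a : ℕ → ℝ) (F : ℂ → ℂ) (b Δ : ℝ), 0 < b → 0 ≤ Δ →
    (∀ r : ℝ, 0 < r → r < 1 → ∀ ε : ℝ, 0 < ε → ∃ T : ℝ, ∀ t : ℝ, T ≤ t →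
      (Set.ncard {m : ℕ | t < m ∧ (m : ℝ) ≤ (1 + r) * t ∧
          ∃ k : ℕ, k < m ∧ a k * a m < 0 ∧ ∀ j : ℕ, k < j → j < m → a j = 0} : ℝ) ≤
        (Δ + ε) * (r * t)) →
    (∀ z : ℂ, ‖z‖ < b → |Complex.arg z| ≤ Real.pi * Δ → AnalyticAt ℂ F z) →
    (∃ ε : ℝ, 0 < ε ∧ ∀ z : ℂ, ‖z‖ < ε → HasSum (fun n ↦ (a n : ℂ) * z ^ n) (F z)) →
    ∀ t : ℝ, 0 ≤ t → t < b → Summable (fun n ↦ a n * t ^ n)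

end Literature.Analysis.Complex
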